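import Literature.IUT.HodgeArakelov.CohomologyAutFunctoriality
import Literature.AnabelianGeometry.EtaleTheta.ContH1CoeffChange

/-!
# `autMap` / `h1TopAut` commute with the change of coefficients, and fix its kernel

Proof-only companion (abc-iut cell, wave-4 seat abc-iut-w4-d014; no definitions, no Prop-valued facts) to
abc-iut-L6-t1's `CohomologyAutFunctoriality.lean` (the action `ContH1Aut.autMap` / `h1TopAut` of an automorphism
pair `(α, β)` on `H¹(H, A)`, p412635) and to `ContH1CoeffChange.lean` (the change of coefficients
`ContH1.coeffChange : H¹(H, A) → H¹(H, A')` along `A ≤ A'`, p412729).  S. Mochizuki, *Inter-universal Teichmüller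
theory II*, kurims manuscript (Dec. 2020), Cor. 1.12 (i) p. 57 l. 9–10: `ι` «induces an “action up to torsion”»
on the étale theta classes; the consumers (GAP row G-w4d010-2, binders (R2) `hsign` / `hroot` of abc-iut-w4-d010's
`prop22_ii'_model`) move such statements between `H¹(Π_Ÿ, l·Δ_Θ)` and `H¹(Π_Ÿ, Δ_Θ)`.  This file supplies the
two bookkeeping facts that make that move possible for the AUTOMORPHISM-PAIR action (the inner case —
`ContH1.conj` — is `ContH1.conj_coeffChange` of p412729):
* `ContH1Aut.coeffChange_autMap` — `coeffChange ∘ autMap (α, β) = autMap (α, β) ∘ coeffChange` (same pair, the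
  coefficient condition `β(A') ⊆ A'` supplied separately); `coeffChange_h1TopAut` — the same on `H¹(H ⊓ ⊤, A)`;
* `ContH1Aut.autMap_eq_of_coeffChange_eq_one` — if `β` fixes `A'` pointwise, then `autMap (α, β)` FIXES every class
  of `H¹(H, A)` killed by `coeffChange` (such a class is `∂a'` with `a' ∈ A'`, and `β ∘ ∂a' ∘ α⁻¹ = ∂(β a') = ∂a'`
  on the nose); `h1TopAut_eq_of_coeffChange_eq_one` — the same on `H¹(H ⊓ ⊤, A)`;
* `ContH1Aut.autMap_eq_conj_of_inner` — an INNER pair `(conj c, conj φ(c))` acts by `ContH1.conj c`;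
* `ContH1Aut.autMap_eq_conj_of_coeffChange_eq` / `h1TopAut_eq_conj_of_coeffChange_eq` — the ODD-TORSION
  TRANSPORT of the `hroot` shape `autMap η = τ₀·η` from `H¹(H, A')` back to `H¹(H, A)` (discrepancy `k` in the
  kernel: `kⁿ = 1`, and `k² = 1` by applying the pair twice — the argument of abc-iut-L2-t8's
  `ContH1.exists_sq_eq_one_of_conj_coeffChange_eq` for the inner case);
* `ContH1Aut.autMap_div_eq_of_coeffChange_eq` — consequently two classes with the same image under `coeffChange`
  have the same "defect" `autMap x / x⁻¹`-wise: `autMap x * (autMap y)⁻¹ = x * y⁻¹`.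
Transport of structure in group cohomology: [NSW] I §5 [cite: NeukirchSchmidtWingberg2008, I §5].  Nothing of
[IUTchII] is asserted (claim key of the ambient interface `Mochizuki2012`, disputed); no side is taken on
[IUTchIII] Cor. 3.12.
-/

namespace Literature.IUT.HodgeArakelov

open Literature.AnabelianGeometry.EtaleTheta

universe u

namespace ContH1Aut

variable {G : Type u} {G' : Type u} [Group G] [TopologicalSpace G]
  [Group G'] [TopologicalSpace G'] [IsTopologicalGroup G']
  (φ : G →* G') {A A' : Subgroup G'} [A.Normal] [IsMulCommutative A] [A'.Normal] [IsMulCommutative A']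
  (hAA' : A ≤ A')

/-- **`coeffChange` commutes with `autMap`**: for an automorphism pair `(α, β)` with `β(A) ⊆ A` and
`β(A') ⊆ A'`, changing coefficients `A ≤ A'` before or after transporting along `(α, β)` gives the same class
(both are the class of `y ↦ β (f (α⁻¹ y))` read in `A'`). [cite: NeukirchSchmidtWingberg2008, I §5] -/
theorem coeffChange_autMap (α : G ≃ₜ* G) (β : G' ≃ₜ* G') (hφ : ∀ g, β (φ g) = φ (α g))
    (hA : ∀ a : G', a ∈ A → β a ∈ A) (hA' : ∀ a : G', a ∈ A' → β a ∈ A')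
    {H H' : Subgroup G} (hH : ∀ x, x ∈ H' → α.symm x ∈ H) (x : ContH1 φ A H) :
    ContH1.coeffChange φ hAA' H' (autMap φ A α β hφ hA hH x) =
      autMap φ A' α β hφ hA' hH (ContH1.coeffChange φ hAA' H x) := by
  induction x using QuotientGroup.induction_on with
  | H f =>
    apply congrArg (QuotientGroup.mk (s := (contCoboundaries φ A' H').subgroupOf (contCocycles φ A' H')))
    apply Subtype.ext
    funext y
    apply Subtype.ext
    rfl

/-- **`autMap` fixes the kernel of `coeffChange`** when `β` is the identity on the larger coefficients `A'`:
a class `x ∈ H¹(H, A)` with `coeffChange x = 1` is represented by `∂a' : h ↦ (φ h) a' (φ h)⁻¹ a'⁻¹` for some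
`a' ∈ A'`, and `β ∘ ∂a' ∘ α⁻¹ = ∂(β a') = ∂a'` (using `β ∘ φ = φ ∘ α`). [cite: NeukirchSchmidtWingberg2008, I §5] -/
theorem autMap_eq_of_coeffChange_eq_one (α : G ≃ₜ* G) (β : G' ≃ₜ* G') (hφ : ∀ g, β (φ g) = φ (α g))
    (hA : ∀ a : G', a ∈ A → β a ∈ A) (hβ : ∀ a : G', a ∈ A' → β a = a)
    {H : Subgroup G} (hH : ∀ x, x ∈ H → α.symm x ∈ H) (x : ContH1 φ A H)
    (hx : ContH1.coeffChange φ hAA' H x = 1) : autMap φ A α β hφ hA hH x = x := by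
  induction x using QuotientGroup.induction_on with
  | H f =>
    have hmem : ContH1.coeffCocycle φ hAA' H f ∈
        (contCoboundaries φ A' H).subgroupOf (contCocycles φ A' H) :=
      (QuotientGroup.eq_one_iff _).mp hx
    obtain ⟨a', ha'⟩ := (mem_contCoboundaries_iff _).mp (Subgroup.mem_subgroupOf.mp hmem)
    have hf : ∀ h : H, ((f.1 h : A) : G') = φ (h : G) * a' * (φ (h : G))⁻¹ * (a' : G')⁻¹ := fun h => by
      have := congrArg (fun b : A' => (b : G')) (congrFun ha' h)
      simpa [MulAut.conjNormal_apply] using this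
    apply congrArg (QuotientGroup.mk (s := (contCoboundaries φ A H).subgroupOf (contCocycles φ A H)))
    apply Subtype.ext
    funext y
    apply Subtype.ext
    rw [coe_autCocycle_apply, hf, hf]
    simp only [map_mul, map_inv, hφ, ContinuousMulEquiv.apply_symm_apply, hβ _ a'.2]

/-- **Equal images under `coeffChange` ⇒ equal `autMap`-defects** (for `β` the identity on `A'`): if
`coeffChange x = coeffChange y` then `autMap x * (autMap y)⁻¹ = x * y⁻¹` — the class `x * y⁻¹` lies in the
kernel of `coeffChange` and is therefore fixed. [cite: NeukirchSchmidtWingberg2008, I §5] -/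
theorem autMap_div_eq_of_coeffChange_eq (α : G ≃ₜ* G) (β : G' ≃ₜ* G') (hφ : ∀ g, β (φ g) = φ (α g))
    (hA : ∀ a : G', a ∈ A → β a ∈ A) (hβ : ∀ a : G', a ∈ A' → β a = a)
    {H : Subgroup G} (hH : ∀ x, x ∈ H → α.symm x ∈ H) (x y : ContH1 φ A H)
    (hxy : ContH1.coeffChange φ hAA' H x = ContH1.coeffChange φ hAA' H y) :
    autMap φ A α β hφ hA hH x * (autMap φ A α β hφ hA hH y)⁻¹ = x * y⁻¹ := by
  have h1 : ContH1.coeffChange φ hAA' H (x * y⁻¹) = 1 := by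
    rw [map_mul, map_inv, hxy, mul_inv_cancel]
  rw [← map_inv, ← map_mul]
  exact autMap_eq_of_coeffChange_eq_one φ hAA' α β hφ hA hβ hH (x * y⁻¹) h1

/-! ## Inner pairs, and the odd-torsion transport of `autMap η = τ₀·η` across `coeffChange` -/

/-- **An inner pair acts by `ContH1.conj`**: if `α` is conjugation by `c` on `G` and `β` is conjugation by
`φ c` on the coefficients `A`, then `autMap (α, β) = ContH1.conj c` on `H¹(H, A)` (`H` normal) — the cocycle
`β ∘ f ∘ α⁻¹` IS `h ↦ φ(c) f(c⁻¹ h c) φ(c)⁻¹`. (Used to evaluate the SQUARE of an automorphism pair lifting an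
involution: `α ∘ α` inner.) [cite: NeukirchSchmidtWingberg2008, I §5] -/
theorem autMap_eq_conj_of_inner [IsTopologicalGroup G] (α : G ≃ₜ* G) (β : G' ≃ₜ* G')
    (hφ : ∀ g, β (φ g) = φ (α g)) (hA : ∀ a : G', a ∈ A → β a ∈ A) {H : Subgroup G} [H.Normal]
    (hH : ∀ x, x ∈ H → α.symm x ∈ H) (c : G) (hαc : ∀ g, α g = c * g * c⁻¹)
    (hβc : ∀ a : G', a ∈ A → β a = φ c * a * (φ c)⁻¹) (x : ContH1 φ A H) :
    autMap φ A α β hφ hA hH x = ContH1.conj φ A c x := by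
  induction x using QuotientGroup.induction_on with
  | H f =>
    rw [autMap_mk, ContH1.conj_mk]
    apply congrArg (QuotientGroup.mk (s := (contCoboundaries φ A H).subgroupOf (contCocycles φ A H)))
    apply Subtype.ext
    funext y
    apply Subtype.ext
    have hy : (⟨α.symm (y : G), hH y y.2⟩ : H) = MulAut.conjNormal c⁻¹ y := by
      apply Subtype.ext
      have h1 : α (c⁻¹ * (y : G) * c) = y := by
        rw [hαc]; group
      change α.symm (y : G) = ((MulAut.conjNormal c⁻¹ y : H) : G)
      rw [MulAut.conjNormal_apply, inv_inv, ← h1, ContinuousMulEquiv.symm_apply_apply, h1]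
    rw [coe_autCocycle_apply, ContH1.conjCocycle_apply, MulAut.conjNormal_apply, hβc _ (f.1 _).2, hy]

/-- **Odd-torsion transport of `autMap η = τ₀·η` across the change of coefficients** (the shape of binder `hroot`
of GAP row G-w4d010-2 (R2): "`ι` carries the root class to a translate").  Let `(α, β)` be an automorphism pair
with `β` the identity on the big coefficients `A'`, `A'`-elements having `n`-th powers in `A`, `n` odd (so
`Ker(coeffChange)` is `n`-torsion and fixed pointwise by `autMap (α, β)`); suppose the pair squares to the inner
pair of `c` on `H¹(H, A)` (`hαα`), that `c·η = (α τ₀ · τ₀)·η` (`hc`), and that `α τ₀` fixes `Ker(coeffChange)`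
pointwise (`hfix`, e.g. `ContH1.conj_eq_self_of_coeffChange_eq_one`).  If the images in `H¹(H, A')` satisfy
`coeffChange (autMap η) = coeffChange (τ₀·η)` (`hΔ`), then already `autMap η = τ₀·η` in `H¹(H, A)`.
PROOF: `k := autMap η / τ₀·η` is in the kernel, so `kⁿ = 1`, `autMap k = k`, `(α τ₀)·k = k`; applying the pair
twice, `c·η = autMap (k · τ₀·η) = k · (α τ₀)·(autMap η) = k · (α τ₀)·(k · τ₀·η) = k · k · c·η`, so `k² = 1`,
whence `k = 1`. [cite: NeukirchSchmidtWingberg2008, I §5] -/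
theorem autMap_eq_conj_of_coeffChange_eq [IsTopologicalGroup G] (α : G ≃ₜ* G) (β : G' ≃ₜ* G')
    (hφ : ∀ g, β (φ g) = φ (α g)) (hA : ∀ a : G', a ∈ A → β a ∈ A) (hβ : ∀ a : G', a ∈ A' → β a = a)
    {H : Subgroup G} [H.Normal] (hH : ∀ x, x ∈ H → α.symm x ∈ H)
    {n : ℕ} (hn : Odd n) (hpow : ∀ a' : A', ((a' : G') ^ n) ∈ A) (η : ContH1 φ A H) (τ₀ c : G)
    (hΔ : ContH1.coeffChange φ hAA' H (autMap φ A α β hφ hA hH η) =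
      ContH1.coeffChange φ hAA' H (ContH1.conj φ A τ₀ η))
    (hαα : ∀ x : ContH1 φ A H,
      autMap φ A α β hφ hA hH (autMap φ A α β hφ hA hH x) = ContH1.conj φ A c x)
    (hc : ContH1.conj φ A c η = ContH1.conj φ A (α τ₀ * τ₀) η)
    (hfix : ∀ k : ContH1 φ A H, ContH1.coeffChange φ hAA' H k = 1 → ContH1.conj φ A (α τ₀) k = k) :
    autMap φ A α β hφ hA hH η = ContH1.conj φ A τ₀ η := by
  -- the discrepancy `k := autMap η / τ₀·η` lies in the kernel of `coeffChange`
  have hk : ContH1.coeffChange φ hAA' H (autMap φ A α β hφ hA hH η / ContH1.conj φ A τ₀ η) = 1 := by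
    rw [map_div, hΔ, div_self']
  have hFk := autMap_eq_of_coeffChange_eq_one φ hAA' α β hφ hA hβ hH _ hk
  have hTk := hfix _ hk
  have hkn : (autMap φ A α β hφ hA hH η / ContH1.conj φ A τ₀ η) ^ n = 1 :=
    ContH1.pow_eq_one_of_coeffChange_eq_one φ hAA' H n hpow _ hk
  have hFη : autMap φ A α β hφ hA hH η =
      (autMap φ A α β hφ hA hH η / ContH1.conj φ A τ₀ η) * ContH1.conj φ A τ₀ η := by
    rw [div_mul_cancel]
  -- apply the pair once more
  have h1 : ContH1.conj φ A c η =
      (autMap φ A α β hφ hA hH η / ContH1.conj φ A τ₀ η) *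
        ((autMap φ A α β hφ hA hH η / ContH1.conj φ A τ₀ η) * ContH1.conj φ A c η) := by
    calc ContH1.conj φ A c η
        = autMap φ A α β hφ hA hH (autMap φ A α β hφ hA hH η) := (hαα η).symm
      _ = autMap φ A α β hφ hA hH
            ((autMap φ A α β hφ hA hH η / ContH1.conj φ A τ₀ η) * ContH1.conj φ A τ₀ η) := by
          rw [← hFη]
      _ = (autMap φ A α β hφ hA hH η / ContH1.conj φ A τ₀ η) *
            ContH1.conj φ A (α τ₀) (autMap φ A α β hφ hA hH η) := by
          rw [map_mul, hFk, autMap_conj]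
      _ = (autMap φ A α β hφ hA hH η / ContH1.conj φ A τ₀ η) *
            ContH1.conj φ A (α τ₀)
              ((autMap φ A α β hφ hA hH η / ContH1.conj φ A τ₀ η) * ContH1.conj φ A τ₀ η) := by
          rw [← hFη]
      _ = (autMap φ A α β hφ hA hH η / ContH1.conj φ A τ₀ η) *
            ((autMap φ A α β hφ hA hH η / ContH1.conj φ A τ₀ η) * ContH1.conj φ A c η) := by
          rw [map_mul, hTk, ← ContH1.conj_mul_apply, ← hc]
  have hsq : (autMap φ A α β hφ hA hH η / ContH1.conj φ A τ₀ η) ^ 2 = 1 := by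
    have h2 : (autMap φ A α β hφ hA hH η / ContH1.conj φ A τ₀ η) *
        (autMap φ A α β hφ hA hH η / ContH1.conj φ A τ₀ η) * ContH1.conj φ A c η =
          1 * ContH1.conj φ A c η := by
      rw [one_mul, mul_assoc]
      exact h1.symm
    rw [pow_two]
    exact mul_right_cancel h2
  -- `k² = 1`, `kⁿ = 1`, `n` odd ⇒ `k = 1`
  have hk1 : autMap φ A α β hφ hA hH η / ContH1.conj φ A τ₀ η = 1 := by
    obtain ⟨m, rfl⟩ := hn
    rw [pow_succ, pow_mul, hsq, one_pow, one_mul] at hkn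
    exact hkn
  rw [hFη, hk1, one_mul]

end ContH1Aut

/-! ## On `H¹(H ⊓ ⊤, A)`: the versions for `h1TopAut` -/

section Top

variable {P : TopGroup.{u}} {G' : Type u} [Group G'] [TopologicalSpace G'] [IsTopologicalGroup G']
  (φ : P →* G') {A A' : Subgroup G'} [A.Normal] [IsMulCommutative A] [A'.Normal] [IsMulCommutative A']
  (hAA' : A ≤ A') (H : Subgroup P)
  (α : P ≃ₜ* P) (β : G' ≃ₜ* G') (hφ : ∀ g, β (φ g) = φ (α g))
  (hA : ∀ a : G', a ∈ A → β a ∈ A) (hH : ∀ x, x ∈ H ↔ α x ∈ H)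

/-- **`coeffChange` commutes with `h1TopAut`** on `H¹(H ⊓ ⊤, A)` (the automorphism-pair action of
`CohomologyAutFunctoriality`): the `A`- and `A'`-valued readings of the action of `(α, β)` agree.
[cite: NeukirchSchmidtWingberg2008, I §5] -/
theorem coeffChange_h1TopAut (hA' : ∀ a : G', a ∈ A' → β a ∈ A') (x : ContH1 φ A (H ⊓ ⊤)) :
    ContH1.coeffChange φ hAA' (H ⊓ ⊤) (h1TopAut φ A H α β hφ hA hH x) =
      h1TopAut φ A' H α β hφ hA' hH (ContH1.coeffChange φ hAA' (H ⊓ ⊤) x) :=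
  ContH1Aut.coeffChange_autMap φ hAA' α β hφ hA hA' (symm_mem_inf_top H α hH) x

/-- **`h1TopAut` fixes the kernel of `coeffChange`** when `β` is the identity on `A'`.
[cite: NeukirchSchmidtWingberg2008, I §5] -/
theorem h1TopAut_eq_of_coeffChange_eq_one (hβ : ∀ a : G', a ∈ A' → β a = a) (x : ContH1 φ A (H ⊓ ⊤))
    (hx : ContH1.coeffChange φ hAA' (H ⊓ ⊤) x = 1) : h1TopAut φ A H α β hφ hA hH x = x :=
  ContH1Aut.autMap_eq_of_coeffChange_eq_one φ hAA' α β hφ hA hβ (symm_mem_inf_top H α hH) x hx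

/-- **Equal images under `coeffChange` ⇒ equal `h1TopAut`-defects** (for `β` the identity on `A'`).
[cite: NeukirchSchmidtWingberg2008, I §5] -/
theorem h1TopAut_div_eq_of_coeffChange_eq (hβ : ∀ a : G', a ∈ A' → β a = a) (x y : ContH1 φ A (H ⊓ ⊤))
    (hxy : ContH1.coeffChange φ hAA' (H ⊓ ⊤) x = ContH1.coeffChange φ hAA' (H ⊓ ⊤) y) :
    h1TopAut φ A H α β hφ hA hH x * (h1TopAut φ A H α β hφ hA hH y)⁻¹ = x * y⁻¹ :=
  ContH1Aut.autMap_div_eq_of_coeffChange_eq φ hAA' α β hφ hA hβ (symm_mem_inf_top H α hH) x y hxy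

/-- **Odd-torsion transport for `h1TopAut`** (`H ⊓ ⊤` normal when `H` is): the `hroot` shape on
`H¹(H ⊓ ⊤, A)` from its image in `H¹(H ⊓ ⊤, A')` — see `ContH1Aut.autMap_eq_conj_of_coeffChange_eq`.
[cite: NeukirchSchmidtWingberg2008, I §5] -/
theorem h1TopAut_eq_conj_of_coeffChange_eq [(H ⊓ (⊤ : Subgroup P)).Normal]
    (hβ : ∀ a : G', a ∈ A' → β a = a) {n : ℕ} (hn : Odd n) (hpow : ∀ a' : A', ((a' : G') ^ n) ∈ A)
    (η : ContH1 φ A (H ⊓ ⊤)) (τ₀ c : P)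
    (hΔ : ContH1.coeffChange φ hAA' (H ⊓ ⊤) (h1TopAut φ A H α β hφ hA hH η) =
      ContH1.coeffChange φ hAA' (H ⊓ ⊤) (ContH1.conj φ A τ₀ η))
    (hαα : ∀ x : ContH1 φ A (H ⊓ ⊤),
      h1TopAut φ A H α β hφ hA hH (h1TopAut φ A H α β hφ hA hH x) = ContH1.conj φ A c x)
    (hc : ContH1.conj φ A c η = ContH1.conj φ A (α τ₀ * τ₀) η)
    (hfix : ∀ k : ContH1 φ A (H ⊓ ⊤), ContH1.coeffChange φ hAA' (H ⊓ ⊤) k = 1 →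
      ContH1.conj φ A (α τ₀) k = k) :
    h1TopAut φ A H α β hφ hA hH η = ContH1.conj φ A τ₀ η :=
  ContH1Aut.autMap_eq_conj_of_coeffChange_eq φ hAA' α β hφ hA hβ (symm_mem_inf_top H α hH) hn hpow η τ₀ c
    hΔ hαα hc hfix

end Top

end Literature.IUT.HodgeArakelov
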